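import Summits.AtomisticToContinuum.FouriersLaw.Theses.MatthiessenLadder
import Summits.AtomisticToContinuum.FouriersLaw.Theorems.MatthiessenLadderPrefixSteadyStatesStubSteadyStateOfSemigroupBound
import Summits.AtomisticToContinuum.FouriersLaw.Theorems.MatthiessenLadderPrefixSteadyStatesStubHarmonicNessUnique
import Summits.AtomisticToContinuum.FouriersLaw.Theorems.MatthiessenLadderPrefixSteadyStatesStubPrefixResponseZero
import Summits.AtomisticToContinuum.FouriersLaw.Theorems.MatthiessenLadderPrefixSteadyStatesStubCellChainSmoothDensity
import Summits.AtomisticToContinuum.FouriersLaw.Theorems.MatthiessenLadderPrefixSteadyStatesStubCellChainInvariantUnique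
import Summits.AtomisticToContinuum.FouriersLaw.Theorems.MatthiessenLadderPrefixSteadyStatesStubCellChainInvariantOfSteadyState
import Summits.AtomisticToContinuum.FouriersLaw.Theorems.MatthiessenLadderPrefixSteadyStatesStubPrefixResponseOfUniformMixing
import Summits.AtomisticToContinuum.FouriersLaw.Theorems.MatthiessenLadderPrefixSteadyStatesStubPrefixWindowDecay
import Summits.AtomisticToContinuum.FouriersLaw.Theorems.MatthiessenLadderPrefixSteadyStatesStubPrefixExpBound
import Summits.AtomisticToContinuum.FouriersLaw.Theorems.MatthiessenLadderPrefixSteadyStatesStubPrefixEnergyScale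
import Summits.AtomisticToContinuum.FouriersLaw.Theorems.MatthiessenLadderPrefixSteadyStatesStubPrefixHostObservability
import Summits.AtomisticToContinuum.FouriersLaw.Theorems.MatthiessenLadderPrefixSteadyStatesStubPrefixMixingOfDecay
import Literature.MathematicalPhysics.KineticTheory.CellChainLangevin
import Literature.MathematicalPhysics.KineticTheory.SiteChainLyapunovInvariant
import Literature.MathematicalPhysics.KineticTheory.HarmonicChainNESS
import Literature.Probability.Process.BrownianSupTail

/-!
# Skeleton — crux `PrefixSteadyStates` of route `MatthiessenLadder` (line `registered`, lead c3, reshape r15)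

Crux item `stmt-AtomisticToContinuum-12778`, decl
`Summit.AtomisticToContinuum.FouriersLaw.Theses.MatthiessenLadder.PrefixSteadyStates`:
for `ω₂, lam, β, γ > 0` and every `k`, the prefix rung `cellChain ω₂ lam β γ (· < k)` (quartic
pinning + quartic coupling switched on exactly at the cells `i < k` of the `ω₂`-pinned harmonic
host) has, at every size `N` and all bath temperatures `T_L, T_R > 0`, a weak steady state that is
unique in the weak Fokker–Planck class, and at every `N`, `T > 0` a finite-`N` response coefficient.

## The cut (reshape r15 = r12 with `stub_prefixMixingOfDecay` LANDED p155758, `stub_prefixWindowDecay` LANDED p155130, `stub_prefixExpBound` LANDED p155391, `stub_prefixEnergyScale` LANDED p155673, `stub_prefixHostObservability` LANDED p155574; r12 = r11 with the new-math estimate isolated as ONE decay stub `stub_prefixUniformDecay` — CEHR Thm 5.1 for the mixed rung — its two former avatars PROVED from it modulo two worker-sized ports `stub_prefixExpBound` (CEHR (3.4)) and `stub_prefixMixingOfDecay` (uniform Harris), and the four inputs of the lead's two-block proof plan for the decay registered: `stub_prefixEnergyScale`, `stub_prefixWindowDecay`, `stub_prefixLimitDissipation` (ports) and `stub_prefixHostObservability`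 (new, linear))

Three regimes of `(k, N)`:

* SATURATED `N ≤ k`: the rung IS `pinnedChain ω₂ lam β γ` at size `N` (`cellChain_const_true` + locality);
  all three clauses are in-tree theorems (`pinnedChain_exists_isSteadyState`, `NessUnique_holds`,
  `FourierGreenKubo.finiteResponse_of_unique`) — discharged inside the composition.
* HARMONIC `k = 0 < N`: the rung IS the pinned harmonic host `pinnedChain ω₂ 0 0 γ`
  (`cellChain_const_false`); existence is in tree (`isSteadyState_harmonicNESS`), uniqueness is the
  LANDED stub `stub_harmonicNessUnique` (p147364: weak-NESS uniqueness of the OU chain — Kalman +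
  local small set + LaSalle for the constructed semigroup, Hörmander + FP identification), and the
  response coefficient is the LANDED stub `stub_prefixResponseZero` (p147366: `D = (N-1)·fluxCoeff`
  along the Gaussian `harmonicNESS`, no uniqueness needed).
* MIXED `0 < k < N` (quartic block `[0,k)` tied by a quartic bond to the harmonic block `[k,N)`): the
  open part.
  - existence = the LANDED construction `cellChain_exists_fellerSemigroup`
    (`Literature/MathematicalPhysics/KineticTheory/CellChainLangevin.lean`, p147636, on top of the lead's
    LANDED `SiteChain` port of `LangevinChainConfined`: SiteChainConfined p147123, SiteChainConfinedDrift
    p147525, SiteChainLangevinKernel p147596 — a Feller `MarkovSemigroupFor` of the rung's generator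
    whose kernels ARE `(cellChain …).langevinKernel`)
    + `prefixCesaroEnergyBound_of_stubs` (a Cesàro bound on `∫ (1+H)² dP_s(x₀, ·)` along those kernels for
    the MIXED rung, PROVED r12 from the registered `stub_prefixUniformDecay` — HARD, the ONLY new mathematics
    of the crux: CEHR Thm 5.1 for the mixed rung, a two-block version of CEHRB 2018 §5 outside their Thm 2.13
    by Rem. 2.11, see `MEMO-EnergyBound.md` §7 — and the registered port `stub_prefixExpBound`, CEHR (3.4))
    + the LANDED soft stub `stub_steadyStateOfSemigroupBound` (Krylov–Bogoliubov + Dynkin, p146884);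
  - uniqueness (`prefixUniquenessPos_of_stubs`, PROVED — all three kernel-level stubs, stated for EVERY
    cell indicator `c`, are LANDED; 20 Literature `SiteChain*.lean` files, ≈ 7k lines, landed by this line):
    `stub_cellChainSmoothDensity` (LANDED p149198 by the wave-2 worker, with Literature ports
    SiteChainHormander.lean p148541 + SiteChainHormanderBrackets.lean p148876: weak steady state ⇒ smooth
    density, Hörmander's bracket condition from one bath since `V_i'' = 1 + 3β_i r² ≥ 1`, CEHRB Prop. 4.1),
    `stub_cellChainInvariantOfSteadyState` (LANDED p151514 by the wave-2 worker, with Literature ports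
    SiteChainReversal p148569, DualityDuhamel p149142, FokkerPlanck{Profiles p149143, IBP p149649, Cutoff
    p149672, Truncation p149982, Defect p150471, Approximation p150799, Invariance p151078}: the
    Fokker–Planck identification weak steady state with smooth density ⇒ invariant for the Langevin kernels),
    `stub_cellChainInvariantUnique` (LANDED p149382 by the wave-2 worker, with Literature ports
    SiteChainLaSalle.lean p148870 + SiteChainLaSalleUniqueness.lean p149199: ≤ 1 invariant probability
    measure — Kalman reduced to the harmonic host at the equilibrium, model-free local small set, LaSalle);
  - response (`prefixResponseOfUniquePos_of_stubs`, PROVED from two registered stubs):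
    `prefixUniformMixing_of_stubs` (PROVED r12 from `stub_prefixUniformDecay` + `stub_prefixExpBound` + the
    registered port `stub_prefixMixingOfDecay`: CEHRB (2.5) uniformly for baths at `(T+δ/2, T-δ/2)`,
    `|δ| < δ₀`: invariant probability measures `ν_δ` of the Langevin kernels with `ν_δ(e^{ϑH}) ≤ C` and
    `|P^δ_t f(z) - ν_δ(f)| ≤ C e^{ϑH(z)} e^{-ct}` for continuous `|f| ≤ e^{ϑH}`; twin of
    `pinnedChain_uniformMixing`) and `stub_prefixResponseOfUniformMixing`
    (R-SOFT, LANDED p152137 by the wave-2 response worker with the Literature ports SiteChainGibbsWeight,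
    SiteChainResponse{RevGenerator, Cutoff, Pairing, Backward, BackwardLimit, Identity, Star, UniformDecay},
    SiteChainKernelContinuity: invariant + Dynkin ⇒ the `ν_δ` are THE weak steady states under uniqueness;
    Gibbs weight at `δ = 0`; finite-time Duhamel response identity; kernel continuity in the bath
    temperatures; dominated convergence for the `δ → 0` limit).

No stub is the crux or the summit: each covers one clause in one regime.
-/

noncomputable section

namespace Summit.AtomisticToContinuum.FouriersLaw.Cruxes.PrefixSteadyStates.Birth

open MeasureTheory Filter Topology
open scoped NNReal ENNReal BoundedContinuousFunction ContDiff
open Literature.MathematicalPhysics.KineticTheory.HeatConduction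
open Summit.AtomisticToContinuum.FouriersLaw.Theses.MatthiessenLadder (PrefixSteadyStates)

/-! The Langevin semigroup of every cell chain (`cellChain_uniformlyConfining`, `cellChain_exists_fellerSemigroup`) is
LANDED: `Literature/MathematicalPhysics/KineticTheory/CellChainLangevin.lean` (p147636). -/

/-! ### A Lyapunov / H2 condition implies the Cesàro energy bound (PROVED; the form in which
CEHRB-type estimates `P_{t*} V ≤ a V + b`, `P_r V ≤ c V` (`r < t*`) will be delivered) -/

section LyapunovToCesaro

open Literature.Probability.Process Literature.MathematicalPhysics.KineticTheory
open scoped ProbabilityTheory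

variable {N : ℕ}

/-- **From a Lyapunov condition to the Cesàro energy bound.** Let `κ t` be Markov kernels with
`κ 0 = id` and Chapman–Kolmogorov, `W ≤ V` measurable weights, and suppose CEHRB's H2 at time `t* > 0`,
`κ_{t*} V ≤ a V + b` with `a < 1`, `b < ∞`, together with the local bound `κ_r V ≤ c V` (`r < t*`, `c < ∞`).
Then from every `x₀` with `V x₀ < ∞` the Cesàro means of `W` are bounded:
`∫_{(0,n+1]} κ_s W (x₀) ds ≤ (n+1) (c V x₀ + B)` (CEHRB (3.5)–(3.6) iterated,
`lintegral_kernel_le_of_lyapunov`, then integrated in time). [folklore] -/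
theorem cesaro_le_of_lyapunov {X : Type*} [MeasurableSpace X] (κ : ℝ≥0 → ProbabilityTheory.Kernel X X)
    [∀ t, ProbabilityTheory.IsMarkovKernel (κ t)]
    (h_zero : κ 0 = ProbabilityTheory.Kernel.id) (h_add : ∀ s t : ℝ≥0, κ (s + t) = κ t ∘ₖ κ s)
    {V W : X → ℝ≥0∞} (hV : Measurable V) (hWV : ∀ y, W y ≤ V y)
    {tstar : ℝ≥0} (htstar : 0 < tstar) {a b c : ℝ≥0∞} (ha : a < 1) (hb : b ≠ ⊤) (hc : c ≠ ⊤)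
    (hlyap : ∀ x, ∫⁻ y, V y ∂(κ tstar x) ≤ a * V x + b)
    (hloc : ∀ r : ℝ≥0, r < tstar → ∀ x, ∫⁻ y, V y ∂(κ r x) ≤ c * V x)
    {x₀ : X} (hx₀ : V x₀ ≠ ⊤) :
    ∃ C : ℝ≥0, ∀ n : ℕ,
      ∫⁻ s in Set.Ioc (0 : ℝ) (n + 1), ∫⁻ y, W y ∂(κ s.toNNReal x₀) ≤ ((n : ℝ≥0∞) + 1) * C := by
  obtain ⟨B, hBtop, hB⟩ := MarkovSemigroup.exists_fixedBound ha hb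
  have hunif : ∀ t : ℝ≥0, ∫⁻ y, W y ∂(κ t x₀) ≤ c * V x₀ + B := fun t =>
    (lintegral_mono fun y => hWV y).trans
      (MarkovSemigroup.lintegral_kernel_le_of_lyapunov κ h_zero h_add hV htstar ha.le hB hlyap hloc t x₀)
  have hKtop : c * V x₀ + B ≠ ⊤ := ENNReal.add_ne_top.2 ⟨ENNReal.mul_ne_top hc hx₀, hBtop⟩
  refine ⟨(c * V x₀ + B).toNNReal, fun n => ?_⟩
  rw [ENNReal.coe_toNNReal hKtop]
  calc ∫⁻ s in Set.Ioc (0 : ℝ) (n + 1), ∫⁻ y, W y ∂(κ s.toNNReal x₀)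
      ≤ ∫⁻ _s in Set.Ioc (0 : ℝ) (n + 1), (c * V x₀ + B) := lintegral_mono fun s => hunif _
    _ = (c * V x₀ + B) * volume (Set.Ioc (0 : ℝ) (n + 1)) := setLIntegral_const _ _
    _ = ((n : ℝ≥0∞) + 1) * (c * V x₀ + B) := by
        rw [Real.volume_Ioc, sub_zero, mul_comm]
        congr 1
        rw [show ((n : ℝ) + 1) = ((n + 1 : ℕ) : ℝ) by push_cast; ring, ENNReal.ofReal_natCast]
        push_cast
        ring

/-- **The Cesàro energy bound of the hard stub from an H2-type Lyapunov condition for the Langevin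
kernels of a cell chain** (`ω₂ > 0`, `lam, β, γ ≥ 0`, any cell indicator, `N ≥ 1`, `T_L, T_R ≥ 0`): if
some measurable `V ≥ (1+H)²` (e.g. `C_θ e^{θH}`) finite at `x₀` satisfies `P_{t*} V ≤ a V + b` (`a < 1`)
and `P_r V ≤ c V` for `r < t*`, then the conclusion of `stub_prefixCesaroEnergyBound` holds at `x₀`. -/
theorem cellChain_cesaroEnergyBound_of_lyapunov {ω₂ lam β γ : ℝ} (hω : 0 < ω₂) (hl : 0 ≤ lam)
    (hβ : 0 ≤ β) (hγ : 0 ≤ γ) (c₀ : ℕ → Bool) {T_L T_R : ℝ}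
    {V : PhaseSpace N → ℝ≥0∞} (hV : Measurable V)
    (hHV : ∀ y, ENNReal.ofReal ((1 + (cellChain ω₂ lam β γ c₀).hamiltonian N y) ^ 2) ≤ V y)
    {tstar : ℝ≥0} (htstar : 0 < tstar) {a b c : ℝ≥0∞} (ha : a < 1) (hb : b ≠ ⊤) (hc : c ≠ ⊤)
    (hlyap : ∀ x, ∫⁻ y, V y ∂((cellChain ω₂ lam β γ c₀).langevinKernel N T_L T_R tstar x) ≤ a * V x + b)
    (hloc : ∀ r : ℝ≥0, r < tstar → ∀ x,
      ∫⁻ y, V y ∂((cellChain ω₂ lam β γ c₀).langevinKernel N T_L T_R r x) ≤ c * V x)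
    {x₀ : PhaseSpace N} (hx₀ : V x₀ ≠ ⊤) :
    ∃ C : ℝ≥0, ∀ n : ℕ,
      ∫⁻ s in Set.Ioc (0 : ℝ) (n + 1),
          ∫⁻ y, ENNReal.ofReal ((1 + (cellChain ω₂ lam β γ c₀).hamiltonian N y) ^ 2)
            ∂((cellChain ω₂ lam β γ c₀).langevinKernel N T_L T_R s.toNNReal x₀) ≤ ((n : ℝ≥0∞) + 1) * C := by
  have hP := cellChain_uniformlyConfining hω hl hβ hγ c₀
  haveI : ∀ t, ProbabilityTheory.IsMarkovKernel ((cellChain ω₂ lam β γ c₀).langevinKernel N T_L T_R t) :=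
    fun t => hP.isMarkovKernel_langevinKernel N T_L T_R t
  exact cesaro_le_of_lyapunov _ (hP.langevinKernel_zero N T_L T_R) (hP.langevinKernel_add N T_L T_R) hV hHV
    htstar ha hb hc hlyap hloc hx₀

/-- **The Cesàro energy bound of the hard stub from a POINTWISE Lyapunov function** (Hairer–Mattingly
2009 Prop. 5.1 route, via the LANDED `SiteChainLyapunovDrift/Invariant.lean`): for a cell chain
(`ω₂ > 0`, `lam, β, γ ≥ 0`, any cell indicator, `N ≥ 1`, `T_L, T_R ≥ 0`), a proper `𝒱 ∈ C²`, `𝒱 ≥ 0`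
with `L𝒱 ≤ C - (1+H)²` pointwise (`C ≥ 0`, `L = (cellChain …).generator N T_L T_R`) gives the conclusion
of `stub_prefixCesaroEnergyBound` at EVERY initial point (with constant `𝒱(x₀) + C`). No such `𝒱` is known
for the mixed rungs (`MEMO-EnergyBound.md` §4); this is the plug. -/
theorem cellChain_cesaroEnergyBound_of_generator_le {ω₂ lam β γ : ℝ} (hω : 0 < ω₂) (hl : 0 ≤ lam)
    (hβ : 0 ≤ β) (hγ : 0 ≤ γ) (c₀ : ℕ → Bool) (hN : 0 < N) {T_L T_R : ℝ} (hTL : 0 ≤ T_L) (hTR : 0 ≤ T_R)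
    {𝒱 : PhaseSpace N → ℝ} (h𝒱 : ContDiff ℝ 2 𝒱) (h𝒱0 : ∀ x, 0 ≤ 𝒱 x)
    (h𝒱c : ∀ R : ℝ, IsCompact {x | 𝒱 x ≤ R}) {C : ℝ} (hC : 0 ≤ C)
    (hLV : ∀ x, (cellChain ω₂ lam β γ c₀).generator N T_L T_R 𝒱 x ≤
      C - (1 + (cellChain ω₂ lam β γ c₀).hamiltonian N x) ^ 2)
    (x₀ : PhaseSpace N) :
    ∃ C' : ℝ≥0, ∀ n : ℕ,
      ∫⁻ s in Set.Ioc (0 : ℝ) (n + 1),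
          ∫⁻ y, ENNReal.ofReal ((1 + (cellChain ω₂ lam β γ c₀).hamiltonian N y) ^ 2)
            ∂((cellChain ω₂ lam β γ c₀).langevinKernel N T_L T_R s.toNNReal x₀) ≤ ((n : ℝ≥0∞) + 1) * C' := by
  have hP := cellChain_uniformlyConfining hω hl hβ hγ c₀
  have hHc : Continuous ((cellChain ω₂ lam β γ c₀).hamiltonian N) :=
    (cellChain ω₂ lam β γ c₀).continuous_hamiltonian N (fun i => (hP.contDiff_U i).continuous)
      (fun i => (hP.contDiff_V i).continuous)
  have hW : Continuous fun y => (1 + (cellChain ω₂ lam β γ c₀).hamiltonian N y) ^ 2 :=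
    (continuous_const.add hHc).pow 2
  have hW0 : ∀ y, 0 ≤ (1 + (cellChain ω₂ lam β γ c₀).hamiltonian N y) ^ 2 := fun y => sq_nonneg _
  refine ⟨(𝒱 x₀ + C).toNNReal, fun n => ?_⟩
  have h := hP.cesaro_lintegral_le_of_generator_le hN hTL hTR h𝒱 h𝒱0 h𝒱c hW hW0 hC hLV x₀ n
  have e : ((𝒱 x₀ + C).toNNReal : ℝ≥0∞) = ENNReal.ofReal (𝒱 x₀ + C) := rfl
  rw [e]
  exact h

end LyapunovToCesaro

/-! ### Toolbox for the hard stubs (PROVED): the interface site of a mixed rung is quartically confined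

The structural fact behind the two-scale heuristic of `MEMO-EnergyBound.md`: on the rung `cellChain (· < k)`
with `0 < k < N`, the first harmonic site `k` cannot carry an amplitude `≫ H^{1/4}` although its own pinning
is only harmonic, because it is tied by the QUARTIC interface bond `(k-1, k)` to the quartic-pinned site
`k-1`: `lam q_{k-1}⁴/4 ≤ H` and `β (q_k - q_{k-1})⁴/4 ≤ H` give `q_k⁴ ≤ 8 (4H/lam + 4H/β)`. -/

section InterfaceConfinement

variable {N : ℕ}

/-- On a mixed rung every quartic cell's pinning energy is below the total energy:
`lam q_i⁴/4 ≤ H` for `i < k` (`ω₂, lam, β ≥ 0`). -/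
theorem prefix_quartic_pinning_le_hamiltonian {ω₂ lam β : ℝ} (hω : 0 ≤ ω₂) (hl : 0 ≤ lam) (hβ : 0 ≤ β)
    (γ : ℝ) {k : ℕ} (x : PhaseSpace N) (i : Fin N) (hi : i.val < k) :
    lam * x.1 i ^ 4 / 4 ≤ (cellChain ω₂ lam β γ (fun j => decide (j < k))).hamiltonian N x := by
  have hP := cellChain_uniformlyConfining' hω hl hβ γ (fun j => decide (j < k))
  have h := (cellChain ω₂ lam β γ (fun j => decide (j < k))).site_le_hamiltonian hP.1 hP.2 N x i
  have hU : (cellChain ω₂ lam β γ (fun j => decide (j < k))).U i.val (x.1 i) =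
      ω₂ * x.1 i ^ 2 / 2 + lam * x.1 i ^ 4 / 4 := by
    show ω₂ * x.1 i ^ 2 / 2 + (if decide (i.val < k) then lam else 0) * x.1 i ^ 4 / 4 = _
    rw [decide_eq_true hi, if_pos rfl]
  rw [hU] at h
  nlinarith [sq_nonneg (x.2 i), mul_nonneg hω (sq_nonneg (x.1 i))]
where
  /-- Nonnegativity of the cell-chain potentials (`ω₂, lam, β ≥ 0`), in the sitewise form consumed by
  `SiteChain.site_le_hamiltonian` / `bond_le_hamiltonian`. -/
  cellChain_uniformlyConfining' {ω₂ lam β : ℝ} (hω : 0 ≤ ω₂) (hl : 0 ≤ lam) (hβ : 0 ≤ β) (γ : ℝ)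
      (c : ℕ → Bool) :
      (∀ i q, 0 ≤ (cellChain ω₂ lam β γ c).U i q) ∧ (∀ i r, 0 ≤ (cellChain ω₂ lam β γ c).V i r) := by
    refine ⟨fun i q => ?_, fun i r => ?_⟩
    · obtain ⟨hl0, -⟩ := ite_amplitude_mem_Icc hl (c i)
      show 0 ≤ ω₂ * q ^ 2 / 2 + (if c i then lam else 0) * q ^ 4 / 4
      positivity
    · obtain ⟨hb0, -⟩ := ite_amplitude_mem_Icc hβ (c i)
      show 0 ≤ r ^ 2 / 2 + (if c i then β else 0) * r ^ 4 / 4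
      positivity

/-- On a mixed rung the interface bond energy is below the total energy:
`β (q_k - q_{k-1})⁴/4 ≤ H` for `0 < k < N` (`ω₂, lam, β ≥ 0`). -/
theorem prefix_interface_bond_le_hamiltonian {ω₂ lam β : ℝ} (hω : 0 ≤ ω₂) (hl : 0 ≤ lam) (hβ : 0 ≤ β)
    (γ : ℝ) {k : ℕ} (hk : 0 < k) (hkN : k < N) (x : PhaseSpace N) :
    β * (x.1 ⟨k, hkN⟩ - x.1 ⟨k - 1, by omega⟩) ^ 4 / 4 ≤
      (cellChain ω₂ lam β γ (fun j => decide (j < k))).hamiltonian N x := by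
  have hP := prefix_quartic_pinning_le_hamiltonian.cellChain_uniformlyConfining' hω hl hβ γ
    (fun j => decide (j < k))
  have hlk : (⟨k, hkN⟩ : Fin N).val = (⟨k - 1, by omega⟩ : Fin N).val + 1 := by
    show k = (k - 1) + 1; omega
  have h := (cellChain ω₂ lam β γ (fun j => decide (j < k))).bond_le_hamiltonian hP.1 hP.2 N x hlk
  have hV : (cellChain ω₂ lam β γ (fun j => decide (j < k))).V (k - 1) (x.1 ⟨k, hkN⟩ - x.1 ⟨k - 1, by omega⟩) =
      (x.1 ⟨k, hkN⟩ - x.1 ⟨k - 1, by omega⟩) ^ 2 / 2 +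
        β * (x.1 ⟨k, hkN⟩ - x.1 ⟨k - 1, by omega⟩) ^ 4 / 4 := by
    show _ ^ 2 / 2 + (if decide (k - 1 < k) then β else 0) * _ ^ 4 / 4 = _
    rw [decide_eq_true (by omega : k - 1 < k), if_pos rfl]
  have h' : (cellChain ω₂ lam β γ (fun j => decide (j < k))).V (⟨k - 1, by omega⟩ : Fin N).val
      (x.1 ⟨k, hkN⟩ - x.1 ⟨k - 1, by omega⟩) ≤ _ := h
  rw [show (⟨k - 1, by omega⟩ : Fin N).val = k - 1 from rfl, hV] at h'
  nlinarith [sq_nonneg (x.1 ⟨k, hkN⟩ - x.1 ⟨k - 1, by omega⟩)]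

/-- **Interface confinement.** On the mixed rung `cellChain (· < k)`, `0 < k < N` (`ω₂ ≥ 0`, `lam, β > 0`),
the first harmonic site is quartically confined by the total energy:
`q_k⁴ ≤ 32 (1/lam + 1/β) H` (from `(a+b)⁴ ≤ 8(a⁴+b⁴)` with `a = q_{k-1}`, `b = q_k - q_{k-1}`). -/
theorem prefix_interface_site_pow_four_le {ω₂ lam β : ℝ} (hω : 0 ≤ ω₂) (hl : 0 < lam) (hβ : 0 < β)
    (γ : ℝ) {k : ℕ} (hk : 0 < k) (hkN : k < N) (x : PhaseSpace N) :
    x.1 ⟨k, hkN⟩ ^ 4 ≤ 32 * (1 / lam + 1 / β) * (cellChain ω₂ lam β γ (fun j => decide (j < k))).hamiltonian N x := by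
  set H := (cellChain ω₂ lam β γ (fun j => decide (j < k))).hamiltonian N x
  set a := x.1 ⟨k - 1, by omega⟩
  set b := x.1 ⟨k, hkN⟩ - x.1 ⟨k - 1, by omega⟩
  have ha : lam * a ^ 4 / 4 ≤ H :=
    prefix_quartic_pinning_le_hamiltonian hω hl.le hβ.le γ x ⟨k - 1, by omega⟩ (by show k - 1 < k; omega)
  have hb : β * b ^ 4 / 4 ≤ H := prefix_interface_bond_le_hamiltonian hω hl.le hβ.le γ hk hkN x
  have hq : x.1 ⟨k, hkN⟩ = a + b := by simp only [a, b]; ring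
  have ha4 : a ^ 4 ≤ 4 / lam * H := by
    rw [div_mul_eq_mul_div, le_div_iff₀ hl]; nlinarith
  have hb4 : b ^ 4 ≤ 4 / β * H := by
    rw [div_mul_eq_mul_div, le_div_iff₀ hβ]; nlinarith
  have hsum : (a + b) ^ 4 ≤ 8 * (a ^ 4 + b ^ 4) := by
    nlinarith [sq_nonneg (a - b), sq_nonneg (a + b), sq_nonneg (a ^ 2 - b ^ 2), sq_nonneg (a * b),
      sq_nonneg (a ^ 2 + b ^ 2 - 2 * a * b)]
  rw [hq]
  calc (a + b) ^ 4 ≤ 8 * (a ^ 4 + b ^ 4) := hsum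
    _ ≤ 8 * (4 / lam * H + 4 / β * H) := by gcongr
    _ = 32 * (1 / lam + 1 / β) * H := by ring

end InterfaceConfinement

/-! ### The stubs (registered; `sorry` only here)

Reshape r12 (lead c3, wave 3). The ONE piece of new mathematics — CEHR Theorem 5.1 (the high-energy decay
of `e^{θH}`) for the MIXED rung — is `stub_prefixUniformDecay`; everything else that the two former stubs
`stub_prefixCesaroEnergyBound` / `stub_prefixUniformMixing` contained is now either PROVED below from it
(`prefixCesaroEnergyBound_of_stubs`, `prefixUniformMixing_of_stubs`) or registered as a worker-sized PORT of
in-tree pinned-chain theory to the cell chains: `stub_prefixExpBound` (CEHR (3.4)), `stub_prefixMixingOfDecay`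
(uniform Harris: decay + (3.4) ⇒ CEHR (2.5) uniformly in the bias), and the four INPUTS of the lead's proof
plan for `stub_prefixUniformDecay` (MEMO-EnergyBound.md §7, the two-block argument): `stub_prefixEnergyScale`
(pathwise energy bookkeeping at scale `K⁴`, port of `LangevinChainEnergyScale`), `stub_prefixWindowDecay`
(the probabilistic shell, port of `LangevinChainH2.pinnedChain_window_decay_of_pathwise`),
`stub_prefixLimitDissipation` (CEHR Prop. 5.14 for the rescaled CELL block `[0,k]`, port of
`LangevinChainLimitFlow`), `stub_prefixHostObservability` (NEW, elementary: observability of the damped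
harmonic HOST block `(k,N)` from the right bath, with the interface site as a bounded forcing). -/

/-- **Stub D (r12) — CEHR Theorem 5.1 with a temperature ceiling for the MIXED rung: THE new mathematics of
the crux.** For `ω₂, lam, β, γ > 0`, `0 < k < N`, a ceiling `Tmax > 0`, `0 < θ < 1/Tmax` and `t* > 0` there is
ONE energy threshold `E₁` such that `P_{t*} e^{θH}(z) ≤ e^{θH(z)}/2` whenever `H(z) ≥ E₁`, for all bath
temperatures `0 < T_L, T_R ≤ Tmax` (`P_t = (cellChain … (· < k)).langevinKernel N T_L T_R t`). Twin of the
tree's `pinnedChain_decay_uniform` (the case `N ≤ k`); for `0 < k < N` the interaction degrees are 4 on the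
bonds `i < k` and 2 on the bonds `i ≥ k`, outside Cuneo–Eckmann–Hairer–Rey-Bellet 2018 Thm 2.13 / §5 by
their Remark 2.11. Proof plan (MEMO-EnergyBound.md §7): at energy `K⁴`, on a fine grid of mesh `Λ/K`,
EITHER the rescaled cell block `[0,k]` carries energy `≥ ε` — then CEHR §5.1 on the cell block (limit
quartic chain with free right end, `stub_prefixLimitDissipation`, the host entering at `O(1/K)`) dissipates
`≥ ε₁K³` at the LEFT bath per cell — OR the harmonic host `(k,N)` carries `≥ K⁴/4` — then linear
observability from the RIGHT bath over a window of order one (`stub_prefixHostObservability`, the interface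
position `q_k = O(K)` by `prefix_interface_site_pow_four_le` entering as forcing) dissipates `≥ c K⁴`;
`twoScale_accounting` sums to `≥ ρK⁴`, and `stub_prefixEnergyScale` + `stub_prefixWindowDecay` turn the
pathwise dissipation into the decay. [cite: CuneoEckmannHairerReyBellet2018, Thm 5.1 and Rem 5.2] -/
theorem stub_prefixUniformDecay :
    ∀ ω₂ lam β γ : ℝ, 0 < ω₂ → 0 < lam → 0 < β → 0 < γ → ∀ k N : ℕ, 0 < k → k < N →
      ∀ Tmax : ℝ, 0 < Tmax → ∀ θ : ℝ, 0 < θ → θ < 1 / Tmax → ∀ tstar : ℝ≥0, 0 < tstar →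
        ∃ E₁ : ℝ, ∀ T_L T_R : ℝ, 0 < T_L → 0 < T_R → T_L ≤ Tmax → T_R ≤ Tmax →
          ∀ z : PhaseSpace N,
            E₁ ≤ (cellChain ω₂ lam β γ (fun i => decide (i < k))).hamiltonian N z →
            ∫⁻ y, ENNReal.ofReal
                (Real.exp (θ * (cellChain ω₂ lam β γ (fun i => decide (i < k))).hamiltonian N y))
                ∂((cellChain ω₂ lam β γ (fun i => decide (i < k))).langevinKernel N T_L T_R tstar z) ≤
              ENNReal.ofReal
                (Real.exp (θ * (cellChain ω₂ lam β γ (fun i => decide (i < k))).hamiltonian N z) / 2) := by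
  sorry

/-! `stub_prefixExpBound` (Stub X, r12: CEHR (3.4)) is LANDED: p155391,
`Summits/AtomisticToContinuum/FouriersLaw/Theorems/MatthiessenLadderPrefixSteadyStatesStubPrefixExpBound.lean`
(+ Literature/MathematicalPhysics/KineticTheory/SiteChainExpBound.lean p154768, generic), imported above. -/

/-! `stub_prefixEnergyScale` (Stub S, r12: pathwise energy bookkeeping at scale `K⁴`) is LANDED: p155673,
`Summits/AtomisticToContinuum/FouriersLaw/Theorems/MatthiessenLadderPrefixSteadyStatesStubPrefixEnergyScale.lean`
(+ Literature SiteChainPathwiseEnergy p154789, CellChainEnergyScale p154872, CellChainEnergyFlow p155394 —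
`cellChain_drivenFlow_energyScale` with the explicit constants `pinnedChainScaleA/B/C`), imported above. -/

/-! `stub_prefixWindowDecay` (Stub W, r12) is LANDED: p155130,
`Summits/AtomisticToContinuum/FouriersLaw/Theorems/MatthiessenLadderPrefixSteadyStatesStubPrefixWindowDecay.lean`
(+ Literature/MathematicalPhysics/KineticTheory/SiteChainWindowDecay.lean p154635, generic for every
`UniformlyConfining` site chain), imported above. -/

/-- **Stub L (r12) — CEHR Prop. 5.14 for the LIMIT CELL BLOCK of the mixed rung** (PORT of
`LangevinChainLimitFlow.exists_le_limitDissipation`): the rescaled high-energy limit of the cell block `[0,k]`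
of `cellChain ω₂ lam β γ (· < k)` is the frictionless, bath-less `(k+1)`-site chain with quartic pinning
`lam q⁴/4` on the sites `i < k`, NO pinning on the interface site `k`, and quartic bonds `β r⁴/4` (the
harmonic host and all degree-2 terms vanish at scale `K⁴`, the host acting on site `k` at `O(1/K)`). For
`lam, β > 0`, `k ≥ 1`, `0 < h₁ ≤ h₀` and `Λ > 0` there is `ε₁ > 0` such that every solution `y` on `[0, Λ]`
of its Hamiltonian equations (`SiteChain.langevinDrift` with `γ = 0`) started in the shell
`h₁ ≤ Ĥ ≤ h₀` dissipates `∫₀^Λ p̂₀(s)² ds ≥ ε₁` at the LEFT bath site: positivity by unique continuation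
along the quartic bonds from site `0` (`p̂₀ ≡ 0 ⇒` all sites at rest `⇒` critical point of the degree-4
homogeneous potential `⇒ Ĥ = 0` by Euler's identity), uniformity by compactness of the shell (`lam > 0`
pins `[0,k)`, the bond pins `k` to `k-1`) and continuous dependence. [cite: CuneoEckmannHairerReyBellet2018, Prop 5.14] -/
theorem stub_prefixLimitDissipation :
    ∀ lam β : ℝ, 0 < lam → 0 < β → ∀ k : ℕ, 0 < k → ∀ h₁ h₀ Λ : ℝ, 0 < h₁ → h₁ ≤ h₀ → 0 < Λ →
      ∃ ε₁ : ℝ, 0 < ε₁ ∧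
        ∀ (x : PhaseSpace (k + 1)) (y : ℝ → PhaseSpace (k + 1)),
          h₁ ≤ SiteChain.hamiltonian
              ({ U := fun i q => (if i < k then lam else 0) * q ^ 4 / 4, V := fun _ r => β * r ^ 4 / 4,
                 γ := 0 } : SiteChain) (k + 1) x →
          SiteChain.hamiltonian
              ({ U := fun i q => (if i < k then lam else 0) * q ^ 4 / 4, V := fun _ r => β * r ^ 4 / 4,
                 γ := 0 } : SiteChain) (k + 1) x ≤ h₀ →
          Continuous y → y 0 = x →
          (∀ t ∈ Set.Ioo (0 : ℝ) Λ,
            HasDerivAt y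
              (SiteChain.langevinDrift
                ({ U := fun i q => (if i < k then lam else 0) * q ^ 4 / 4, V := fun _ r => β * r ^ 4 / 4,
                   γ := 0 } : SiteChain) (k + 1) (y t)) t) →
          ε₁ ≤ ∫ s in (0 : ℝ)..Λ, (y s).2 ⟨0, Nat.succ_pos k⟩ ^ 2 := by
  sorry

/-! `stub_prefixHostObservability` (Stub O, r12, NEW: observability of the damped harmonic host block
with the interface as bounded forcing) is LANDED: p155574,
`Summits/AtomisticToContinuum/FouriersLaw/Theorems/MatthiessenLadderPrefixSteadyStatesStubPrefixHostObservability.lean`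
(+ Literature/Analysis/ODE/LinearObservability.lean p154937, Literature/…/DampedHarmonicBlockObservability.lean
p155384), imported above. -/

/-- `(1 + h)² ≤ (2 + 4/θ²) e^{θh}` for `h ≥ 0`, `θ > 0`. [folklore] -/
theorem one_add_sq_le_mul_exp {θ h : ℝ} (hθ : 0 < θ) (hh : 0 ≤ h) :
    (1 + h) ^ 2 ≤ (2 + 4 / θ ^ 2) * Real.exp (θ * h) := by
  have h1 : 1 ≤ Real.exp (θ * h) := Real.one_le_exp (by positivity)
  have h2 : (θ * h) ^ 2 / 2 ≤ Real.exp (θ * h) := by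
    have := Real.pow_div_factorial_le_exp (θ * h) (by positivity) 2
    simpa [Nat.factorial] using this
  have hθ2 : 0 < θ ^ 2 := by positivity
  -- `h² ≤ (2/θ²) e^{θh}`
  have h3 : θ ^ 2 * h ^ 2 ≤ 2 * Real.exp (θ * h) := by nlinarith
  have h3' : h ^ 2 ≤ 2 / θ ^ 2 * Real.exp (θ * h) := by
    rw [div_mul_eq_mul_div, le_div_iff₀ hθ2]; linarith
  have h4 : (1 + h) ^ 2 ≤ 2 + 2 * h ^ 2 := by nlinarith [sq_nonneg (1 - h)]
  have h5 : (2 : ℝ) ≤ 2 * Real.exp (θ * h) := by linarith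
  calc (1 + h) ^ 2 ≤ 2 + 2 * h ^ 2 := h4
    _ ≤ 2 * Real.exp (θ * h) + 2 * (2 / θ ^ 2 * Real.exp (θ * h)) := by linarith
    _ = (2 + 4 / θ ^ 2) * Real.exp (θ * h) := by ring

/-- **The Cesàro energy bound along the Langevin kernels of the MIXED rung** (the r4–r11 stub
`stub_prefixCesaroEnergyBound`, now PROVED from `stub_prefixUniformDecay` + `stub_prefixExpBound` through
`cellChain_cesaroEnergyBound_of_lyapunov` with `V = (2 + 4/θ²) e^{θH}`, `θ = 1/(2 max(T_L,T_R))`, `t* = 1`). -/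
theorem prefixCesaroEnergyBound_of_stubs :
    ∀ ω₂ lam β γ : ℝ, 0 < ω₂ → 0 < lam → 0 < β → 0 < γ → ∀ k N : ℕ, 0 < k → k < N →
      ∀ T_L T_R : ℝ, 0 < T_L → 0 < T_R →
        ∃ (x₀ : PhaseSpace N) (C : ℝ≥0), ∀ n : ℕ,
          ∫⁻ s in Set.Ioc (0 : ℝ) (n + 1),
              ∫⁻ y, ENNReal.ofReal
                ((1 + (cellChain ω₂ lam β γ (fun i => decide (i < k))).hamiltonian N y) ^ 2)
                ∂((cellChain ω₂ lam β γ (fun i => decide (i < k))).langevinKernel N T_L T_R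
                    s.toNNReal x₀) ≤ ((n : ℝ≥0∞) + 1) * C := by
  intro ω₂ lam β γ hω hl hβ hγ k N hk hkN T_L T_R hL hR
  set P := cellChain ω₂ lam β γ (fun i => decide (i < k)) with hP
  set H := P.hamiltonian N with hH
  have hN : 0 < N := lt_of_le_of_lt (Nat.zero_le k) hkN
  have hUC := cellChain_uniformlyConfining hω hl.le hβ.le hγ.le (fun i => decide (i < k))
  -- the parameters
  set Tm := max T_L T_R with hTm
  have hTm0 : 0 < Tm := lt_max_of_lt_left hL
  set θ : ℝ := 1 / (2 * Tm) with hθ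
  have hθ0 : 0 < θ := by positivity
  have hθ1 : θ < 1 / Tm := by
    rw [hθ]; exact one_div_lt_one_div_of_lt hTm0 (by linarith)
  obtain ⟨E₁, hE₁⟩ := stub_prefixUniformDecay ω₂ lam β γ hω hl hβ hγ k N hk hkN Tm hTm0 θ hθ0 hθ1 1 one_pos
  have hdec := hE₁ T_L T_R hL hR (le_max_left _ _) (le_max_right _ _)
  have h34 := Summit.AtomisticToContinuum.FouriersLaw.Theorems.PrefixSteadyStates.LineRegistered.stub_prefixExpBound
    ω₂ lam β γ hω hl.le hβ.le hγ (fun i => decide (i < k)) N hN T_L T_R hL hR θ hθ0 hθ1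
  -- the Lyapunov function `V = Mθ e^{θH}`
  set Mθ : ℝ := 2 + 4 / θ ^ 2 with hMθ
  have hMθ0 : 0 < Mθ := by positivity
  have hHc : Continuous H := P.continuous_hamiltonian N (fun i => (hUC.contDiff_U i).continuous)
    (fun i => (hUC.contDiff_V i).continuous)
  have hH0 : ∀ y, 0 ≤ H y := fun y => hUC.hamiltonian_nonneg N y
  set V : PhaseSpace N → ℝ≥0∞ := fun y => ENNReal.ofReal (Mθ * Real.exp (θ * H y)) with hV
  have hVm : Measurable V :=
    ENNReal.measurable_ofReal.comp (measurable_const.mul (Real.measurable_exp.comp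
      (measurable_const.mul hHc.measurable)))
  have hVsplit : ∀ y, V y = ENNReal.ofReal Mθ * ENNReal.ofReal (Real.exp (θ * H y)) := fun y => by
    rw [hV]; exact ENNReal.ofReal_mul hMθ0.le
  have hEm : Measurable fun y => ENNReal.ofReal (Real.exp (θ * H y)) :=
    ENNReal.measurable_ofReal.comp (Real.measurable_exp.comp (measurable_const.mul hHc.measurable))
  have hHV : ∀ y, ENNReal.ofReal ((1 + H y) ^ 2) ≤ V y := fun y =>
    ENNReal.ofReal_le_ofReal (one_add_sq_le_mul_exp hθ0 (hH0 y))
  -- the exponential factor of (3.4) at times `≤ 1`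
  set G : ℝ := Real.exp (θ * γ * (T_L + T_R) * (1 : ℝ≥0)) with hG
  have hG34 : ∀ (r : ℝ≥0), (r : ℝ) ≤ 1 → ∀ x, ∫⁻ y, V y ∂(P.langevinKernel N T_L T_R r x) ≤
      ENNReal.ofReal G * V x := by
    intro r hr x
    calc ∫⁻ y, V y ∂(P.langevinKernel N T_L T_R r x)
        = ENNReal.ofReal Mθ * ∫⁻ y, ENNReal.ofReal (Real.exp (θ * H y)) ∂(P.langevinKernel N T_L T_R r x) := by
          simp only [hVsplit]; exact lintegral_const_mul _ hEm
      _ ≤ ENNReal.ofReal Mθ * ENNReal.ofReal (Real.exp (θ * γ * (T_L + T_R) * r) * Real.exp (θ * H x)) := by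
          gcongr; exact h34 r x
      _ ≤ ENNReal.ofReal Mθ * (ENNReal.ofReal G * ENNReal.ofReal (Real.exp (θ * H x))) := by
          gcongr
          rw [← ENNReal.ofReal_mul (Real.exp_pos _).le]
          refine ENNReal.ofReal_le_ofReal (mul_le_mul_of_nonneg_right ?_ (Real.exp_pos _).le)
          refine Real.exp_le_exp.2 (mul_le_mul_of_nonneg_left (by simpa using hr) ?_)
          have := hγ.le; have := hL.le; have := hR.le; positivity
      _ = ENNReal.ofReal G * V x := by rw [hVsplit, mul_left_comm]
  -- H2 at `t* = 1`
  set b : ℝ≥0∞ := ENNReal.ofReal G * ENNReal.ofReal (Mθ * Real.exp (θ * E₁)) with hb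
  have hlyap : ∀ x, ∫⁻ y, V y ∂(P.langevinKernel N T_L T_R 1 x) ≤ (1 / 2 : ℝ≥0∞) * V x + b := by
    intro x
    by_cases hx : E₁ ≤ H x
    · calc ∫⁻ y, V y ∂(P.langevinKernel N T_L T_R 1 x)
          = ENNReal.ofReal Mθ * ∫⁻ y, ENNReal.ofReal (Real.exp (θ * H y)) ∂(P.langevinKernel N T_L T_R 1 x) := by
            simp only [hVsplit]; exact lintegral_const_mul _ hEm
        _ ≤ ENNReal.ofReal Mθ * ENNReal.ofReal (Real.exp (θ * H x) / 2) := by gcongr; exact hdec x hx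
        _ = (1 / 2 : ℝ≥0∞) * V x := by
            rw [hVsplit, div_eq_mul_inv, ENNReal.ofReal_mul (Real.exp_pos _).le,
              ENNReal.ofReal_inv_of_pos (by norm_num : (0:ℝ) < 2), ENNReal.ofReal_ofNat]
            rw [one_div]; ring
        _ ≤ (1 / 2 : ℝ≥0∞) * V x + b := le_self_add
    · have hx' : H x ≤ E₁ := le_of_lt (not_le.1 hx)
      calc ∫⁻ y, V y ∂(P.langevinKernel N T_L T_R 1 x) ≤ ENNReal.ofReal G * V x := hG34 1 (by simp) x
        _ ≤ b := by
            rw [hb]; gcongr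
            exact ENNReal.ofReal_le_ofReal
              (mul_le_mul_of_nonneg_left (Real.exp_le_exp.2 (mul_le_mul_of_nonneg_left hx' hθ0.le)) hMθ0.le)
        _ ≤ (1 / 2 : ℝ≥0∞) * V x + b := le_add_self
  have hloc : ∀ r : ℝ≥0, r < 1 → ∀ x, ∫⁻ y, V y ∂(P.langevinKernel N T_L T_R r x) ≤ ENNReal.ofReal G * V x :=
    fun r hr x => hG34 r (by exact_mod_cast hr.le) x
  obtain ⟨C, hC⟩ := cellChain_cesaroEnergyBound_of_lyapunov (N := N) hω hl.le hβ.le hγ.le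
    (fun i => decide (i < k)) (T_L := T_L) (T_R := T_R) hVm hHV one_pos
    (a := 1 / 2) (b := b) (c := ENNReal.ofReal G) (by rw [one_div]; exact ENNReal.inv_lt_one.2 (by norm_num))
    (ENNReal.mul_ne_top ENNReal.ofReal_ne_top ENNReal.ofReal_ne_top) ENNReal.ofReal_ne_top hlyap hloc
    (x₀ := 0) ENNReal.ofReal_ne_top
  exact ⟨0, C, hC⟩

/-- **A Feller semigroup of the MIXED rung with a Cesàro-bounded `(1+H)²`-orbit** (the r1–r3 hard
stub, PROVED from `cellChain_exists_fellerSemigroup` + `prefixCesaroEnergyBound_of_stubs`). -/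
theorem prefixSemigroupEnergyBound_of_stubs :
    ∀ ω₂ lam β γ : ℝ, 0 < ω₂ → 0 < lam → 0 < β → 0 < γ → ∀ k N : ℕ, 0 < k → k < N →
      ∀ T_L T_R : ℝ, 0 < T_L → 0 < T_R →
        ∃ S : MarkovSemigroupFor
            ((cellChain ω₂ lam β γ (fun i => decide (i < k))).generator N T_L T_R),
          (∀ (t : ℝ≥0) (g : PhaseSpace N →ᵇ ℝ), Continuous fun x => ∫ y, g y ∂(S.kernel t x)) ∧
          ∃ (x₀ : PhaseSpace N) (C : ℝ≥0), ∀ n : ℕ,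
            ∫⁻ s in Set.Ioc (0 : ℝ) (n + 1),
                ∫⁻ y, ENNReal.ofReal
                  ((1 + (cellChain ω₂ lam β γ (fun i => decide (i < k))).hamiltonian N y) ^ 2)
                  ∂(S.kernel s.toNNReal x₀) ≤ ((n : ℝ≥0∞) + 1) * C := by
  intro ω₂ lam β γ hω hl hβ hγ k N hk hkN T_L T_R hL hR
  obtain ⟨S, hFeller, hker⟩ := cellChain_exists_fellerSemigroup hω hl.le hβ.le hγ.le
    (fun i => decide (i < k)) (lt_of_le_of_lt (Nat.zero_le k) hkN) hL.le hR.le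
  obtain ⟨x₀, C, hC⟩ := prefixCesaroEnergyBound_of_stubs ω₂ lam β γ hω hl hβ hγ k N hk hkN T_L T_R hL hR
  refine ⟨S, hFeller, x₀, C, fun n => ?_⟩
  simp only [hker]
  exact hC n

/-- **Uniqueness in the weak class on the MIXED rungs** (the r2–r4 stub U₊, now PROVED from the three
kernel-level stubs): two weak steady states have smooth densities (U-a), are invariant for the Langevin
kernels (U-b), hence coincide (U-c). -/
theorem prefixUniquenessPos_of_stubs :
    ∀ ω₂ lam β γ : ℝ, 0 < ω₂ → 0 < lam → 0 < β → 0 < γ → ∀ k N : ℕ, 0 < k → k < N →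
      ∀ T_L T_R : ℝ, 0 < T_L → 0 < T_R →
        ∀ μ ν : Measure (PhaseSpace N),
          (cellChain ω₂ lam β γ (fun i => decide (i < k))).IsSteadyState N T_L T_R μ →
          (cellChain ω₂ lam β γ (fun i => decide (i < k))).IsSteadyState N T_L T_R ν → μ = ν := by
  intro ω₂ lam β γ hω hl hβ hγ k N _hk hkN T_L T_R hL hR μ ν hμ hν
  have hN : 0 < N := lt_of_le_of_lt (Nat.zero_le k) hkN
  haveI := hμ.1
  haveI := hν.1
  exact Summit.AtomisticToContinuum.FouriersLaw.Theorems.PrefixSteadyStates.LineRegistered.stub_cellChainInvariantUnique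
    ω₂ lam β γ hω hl.le hβ.le hγ (fun i => decide (i < k)) N hN T_L T_R hL hR.le μ ν hμ.1 hν.1
    (Summit.AtomisticToContinuum.FouriersLaw.Theorems.PrefixSteadyStates.LineRegistered.stub_cellChainInvariantOfSteadyState
      ω₂ lam β γ hω hl.le hβ.le hγ _ N hN T_L T_R hL hR μ hμ
      (Summit.AtomisticToContinuum.FouriersLaw.Theorems.PrefixSteadyStates.LineRegistered.stub_cellChainSmoothDensity
        ω₂ lam β γ hω hl.le hβ.le hγ _ N hN T_L T_R hL hR μ hμ))
    (Summit.AtomisticToContinuum.FouriersLaw.Theorems.PrefixSteadyStates.LineRegistered.stub_cellChainInvariantOfSteadyState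
      ω₂ lam β γ hω hl.le hβ.le hγ _ N hN T_L T_R hL hR ν hν
      (Summit.AtomisticToContinuum.FouriersLaw.Theorems.PrefixSteadyStates.LineRegistered.stub_cellChainSmoothDensity
        ω₂ lam β γ hω hl.le hβ.le hγ _ N hN T_L T_R hL hR ν hν))

/-! `stub_prefixMixingOfDecay` (Stub M, r12: uniform Harris — decay + (3.4) ⇒ CEHR (2.5) uniformly in the
bias, with invariant probability measures) is LANDED: p155758,
`Summits/AtomisticToContinuum/FouriersLaw/Theorems/MatthiessenLadderPrefixSteadyStatesStubPrefixMixingOfDecay.lean`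
(+ Literature ConfinedLocalMinorizationUniform p154851, SiteChainUniformReach p154945, SiteChainUniformMinorization
p155415), imported above. -/

/-- **Uniform exponential mixing of the MIXED rung near equal temperatures** (the r6–r11 stub
`stub_prefixUniformMixing`, now PROVED from `stub_prefixUniformDecay` + `stub_prefixExpBound` +
`stub_prefixMixingOfDecay`, with `δ₀ = T`, `ϑ = 1/(3T)`, ceiling `Tmax = 3T/2`): CEHRB (2.5) with constants
uniform in the bias `|δ| < δ₀` for the kernels with baths at `(T+δ/2, T-δ/2)`, invariant probability measures
`ν_δ` with `ν_δ(e^{ϑH}) ≤ C`. [cite: CuneoEckmannHairerReyBellet2018, Thm 2.13] -/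
theorem prefixUniformMixing_of_stubs :
    ∀ ω₂ lam β γ : ℝ, 0 < ω₂ → 0 < lam → 0 < β → 0 < γ → ∀ k N : ℕ, 0 < k → k < N → ∀ T : ℝ, 0 < T →
      ∃ (δ₀ ϑ C c : ℝ), 0 < δ₀ ∧ δ₀ < 2 * T ∧ 0 < ϑ ∧ ϑ * (T + δ₀ / 2) < 1 ∧ 0 ≤ C ∧ 0 < c ∧
        ∀ δ : ℝ, |δ| < δ₀ →
          ∃ ν : Measure (PhaseSpace N), IsProbabilityMeasure ν ∧
            (∀ t : ℝ≥0, ProbabilityTheory.Kernel.Invariant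
              ((cellChain ω₂ lam β γ (fun i => decide (i < k))).langevinKernel N (T + δ / 2) (T - δ / 2) t) ν) ∧
            (∫ y, Real.exp (ϑ * (cellChain ω₂ lam β γ (fun i => decide (i < k))).hamiltonian N y) ∂ν ≤ C) ∧
            ∀ (z : PhaseSpace N) (t : ℝ≥0) (f : PhaseSpace N → ℝ), Continuous f →
              (∀ y, |f y| ≤ Real.exp (ϑ * (cellChain ω₂ lam β γ (fun i => decide (i < k))).hamiltonian N y)) →
              |(∫ y, f y ∂((cellChain ω₂ lam β γ (fun i => decide (i < k))).langevinKernel N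
                    (T + δ / 2) (T - δ / 2) t z)) - ∫ y, f y ∂ν| ≤
                C * Real.exp (ϑ * (cellChain ω₂ lam β γ (fun i => decide (i < k))).hamiltonian N z) *
                  Real.exp (-c * t) := by
  intro ω₂ lam β γ hω hl hβ hγ k N hk hkN T hT
  have hN : 0 < N := lt_of_le_of_lt (Nat.zero_le k) hkN
  have hT0 : T ≠ 0 := hT.ne'
  obtain ⟨δ₀, hδ₀⟩ : ∃ δ₀ : ℝ, δ₀ = T := ⟨T, rfl⟩
  obtain ⟨ϑ, hϑ⟩ : ∃ ϑ : ℝ, ϑ = 1 / (3 * T) := ⟨_, rfl⟩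
  have hδ₀0 : 0 < δ₀ := by rw [hδ₀]; exact hT
  have hδ₀2 : δ₀ < 2 * T := by rw [hδ₀]; linarith
  have hϑ0 : 0 < ϑ := by rw [hϑ]; positivity
  have hϑ1 : ϑ * (T + δ₀ / 2) < 1 := by
    rw [hϑ, hδ₀]
    have e : 1 / (3 * T) * (T + T / 2) = 1 / 2 := by field_simp; ring
    rw [e]; norm_num
  -- the ceiling
  obtain ⟨Tmax, hTmax⟩ : ∃ Tmax : ℝ, Tmax = T + δ₀ / 2 := ⟨_, rfl⟩
  have hTmax0 : 0 < Tmax := by rw [hTmax]; positivity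
  have hϑT : ϑ < 1 / Tmax := by
    rw [lt_div_iff₀ hTmax0, hTmax]; exact hϑ1
  have htemp : ∀ δ : ℝ, |δ| < δ₀ →
      0 < T + δ / 2 ∧ 0 < T - δ / 2 ∧ T + δ / 2 ≤ Tmax ∧ T - δ / 2 ≤ Tmax := by
    intro δ hδ
    rw [hδ₀] at hδ
    have h1 := (abs_lt.1 hδ).1
    have h2 := (abs_lt.1 hδ).2
    refine ⟨by linarith, by linarith, by rw [hTmax, hδ₀]; linarith, by rw [hTmax, hδ₀]; linarith⟩
  -- (3.4) for every biased pair
  have h34 : ∀ δ : ℝ, |δ| < δ₀ → ∀ θ : ℝ, 0 < θ → θ < 1 / max (T + δ / 2) (T - δ / 2) →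
      ∀ (t : ℝ≥0) (z : PhaseSpace N),
        ∫⁻ y, ENNReal.ofReal (Real.exp (θ * (cellChain ω₂ lam β γ (fun i => decide (i < k))).hamiltonian N y))
            ∂((cellChain ω₂ lam β γ (fun i => decide (i < k))).langevinKernel N (T + δ / 2) (T - δ / 2) t z) ≤
          ENNReal.ofReal (Real.exp (θ * γ * ((T + δ / 2) + (T - δ / 2)) * t) *
            Real.exp (θ * (cellChain ω₂ lam β γ (fun i => decide (i < k))).hamiltonian N z)) :=
    fun δ hδ θ hθ hθ' t z =>
      Summit.AtomisticToContinuum.FouriersLaw.Theorems.PrefixSteadyStates.LineRegistered.stub_prefixExpBound ω₂ lam β γ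
        hω hl.le hβ.le hγ (fun i => decide (i < k)) N hN (T + δ / 2) (T - δ / 2)
        (htemp δ hδ).1 (htemp δ hδ).2.1 θ hθ hθ' t z
  -- the uniform decay from the ceiling form
  have hdecay : ∀ tstar : ℝ≥0, 0 < tstar → ∃ E₁ : ℝ, ∀ δ : ℝ, |δ| < δ₀ → ∀ z : PhaseSpace N,
      E₁ ≤ (cellChain ω₂ lam β γ (fun i => decide (i < k))).hamiltonian N z →
        ∫⁻ y, ENNReal.ofReal (Real.exp (ϑ * (cellChain ω₂ lam β γ (fun i => decide (i < k))).hamiltonian N y))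
            ∂((cellChain ω₂ lam β γ (fun i => decide (i < k))).langevinKernel N (T + δ / 2) (T - δ / 2) tstar z) ≤
          ENNReal.ofReal (Real.exp (ϑ * (cellChain ω₂ lam β γ (fun i => decide (i < k))).hamiltonian N z) / 2) := by
    intro tstar htstar
    obtain ⟨E₁, hE₁⟩ := stub_prefixUniformDecay ω₂ lam β γ hω hl hβ hγ k N hk hkN Tmax hTmax0 ϑ hϑ0 hϑT
      tstar htstar
    exact ⟨E₁, fun δ hδ z hz => hE₁ (T + δ / 2) (T - δ / 2) (htemp δ hδ).1 (htemp δ hδ).2.1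
      (htemp δ hδ).2.2.1 (htemp δ hδ).2.2.2 z hz⟩
  obtain ⟨C, r, hC, hr, hmix⟩ :=
    Summit.AtomisticToContinuum.FouriersLaw.Theorems.PrefixSteadyStates.LineRegistered.stub_prefixMixingOfDecay
      ω₂ lam β γ hω hl.le hβ.le hγ (fun i => decide (i < k)) N hN T δ₀ ϑ hT hδ₀0 hδ₀2 hϑ0 hϑ1 h34 hdecay
  exact ⟨δ₀, ϑ, C, r, hδ₀0, hδ₀2, hϑ0, hϑ1, hC, hr, hmix⟩

/-- **Finite response of the unique steady state on the MIXED rungs** (the r2–r6 stub R₊, now PROVED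
from `prefixUniformMixing_of_stubs` + the LANDED `stub_prefixResponseOfUniformMixing`). -/
theorem prefixResponseOfUniquePos_of_stubs :
    ∀ ω₂ lam β γ : ℝ, 0 < ω₂ → 0 < lam → 0 < β → 0 < γ → ∀ k N : ℕ, 0 < k → k < N →
      (∀ T_L T_R : ℝ, 0 < T_L → 0 < T_R →
        ∃ μ : Measure (PhaseSpace N),
          (cellChain ω₂ lam β γ (fun i => decide (i < k))).IsSteadyState N T_L T_R μ ∧
          ∀ ν : Measure (PhaseSpace N),
            (cellChain ω₂ lam β γ (fun i => decide (i < k))).IsSteadyState N T_L T_R ν → ν = μ) →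
      ∀ T : ℝ, 0 < T →
        ∃ D : ℝ, (cellChain ω₂ lam β γ (fun i => decide (i < k))).IsResponseCoeff N T D :=
  fun ω₂ lam β γ hω hl hβ hγ k N hk hkN hEU T hT =>
    Summit.AtomisticToContinuum.FouriersLaw.Theorems.PrefixSteadyStates.LineRegistered.stub_prefixResponseOfUniformMixing
      ω₂ lam β γ hω hl hβ hγ k N hk hkN hEU T hT (prefixUniformMixing_of_stubs ω₂ lam β γ hω hl hβ hγ k N hk hkN T hT)

/-! ### The harmonic regime `k = 0`: the rung IS the pinned harmonic host (proved, no sorry) -/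

/-- The `k = 0` cell indicator is identically `false`. -/
theorem decide_lt_zero_eq : (fun i : ℕ => decide (i < 0)) = fun _ => false := by
  funext i; simp

/-- The `k = 0` rung IS the pinned harmonic host `pinnedChain ω₂ 0 0 γ` (as a site chain). -/
theorem cellChain_lt_zero_eq (ω₂ lam β γ : ℝ) :
    cellChain ω₂ lam β γ (fun i => decide (i < 0)) = (pinnedChain ω₂ 0 0 γ).toSiteChain := by
  rw [decide_lt_zero_eq, cellChain_const_false]

/-- Steady states of the `k = 0` rung are those of the pinned harmonic chain. -/
theorem isSteadyState_prefix_zero (ω₂ lam β γ : ℝ) (N : ℕ) :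
    (cellChain ω₂ lam β γ (fun i => decide (i < 0))).IsSteadyState N =
      (pinnedChain ω₂ 0 0 γ).IsSteadyState N := by
  rw [cellChain_lt_zero_eq, OscillatorChain.toSiteChain_isSteadyState]

/-! ### The saturated regime `N ≤ k`: the rung IS the pinned chain (proved, no sorry) -/

/-- For `N ≤ k` every cell below `N` is switched on, so the steady-state predicate of the prefix
rung at size `N` is literally that of `pinnedChain ω₂ lam β γ`. -/
theorem isSteadyState_prefix_of_le (ω₂ lam β γ : ℝ) {k N : ℕ} (h : N ≤ k) :
    (cellChain ω₂ lam β γ (fun i => decide (i < k))).IsSteadyState N =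
      (pinnedChain ω₂ lam β γ).IsSteadyState N := by
  rw [cellChain_isSteadyState_congr ω₂ lam β γ (c := fun i => decide (i < k)) (c' := fun _ => true)
      (fun i hi => by simp [lt_of_lt_of_le hi h]), cellChain_const_true,
    OscillatorChain.toSiteChain_isSteadyState]

/-- For `N ≤ k` the response coefficients of the prefix rung at size `N` are those of the pinned
chain (as a site chain). -/
theorem isResponseCoeff_prefix_of_le (ω₂ lam β γ : ℝ) {k N : ℕ} (h : N ≤ k) :
    (cellChain ω₂ lam β γ (fun i => decide (i < k))).IsResponseCoeff N =
      (pinnedChain ω₂ lam β γ).toSiteChain.IsResponseCoeff N := by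
  rw [cellChain_isResponseCoeff_congr ω₂ lam β γ (c := fun i => decide (i < k)) (c' := fun _ => true)
      (fun i hi => by simp [lt_of_lt_of_le hi h]), cellChain_const_true]

/-- Response coefficients of a homogeneous chain viewed as a site chain, unfolded (`Iff.rfl`). -/
theorem isResponseCoeff_toSiteChain_iff (P : OscillatorChain) (N : ℕ) (T D : ℝ) :
    P.toSiteChain.IsResponseCoeff N T D ↔
      ∃ μ : ℝ → ℝ → Measure (PhaseSpace N),
        (∀ T_L T_R : ℝ, 0 < T_L → 0 < T_R → P.IsSteadyState N T_L T_R (μ T_L T_R)) ∧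
        Tendsto (fun δ : ℝ => P.totalCurrent (μ (T + δ / 2) (T - δ / 2)) / δ) (𝓝[≠] 0) (𝓝 D) :=
  Iff.rfl

/-- The pinned chain has a response coefficient at every size and temperature: canonical
steady-state family by choice (`pinnedChain_exists_isSteadyState`, PROVED), weak-NESS uniqueness
(`NessUnique_holds`, PROVED) and the finite-`N` response theorem
(`FourierGreenKubo.finiteResponse_of_unique`, PROVED). -/
theorem pinnedChain_exists_isResponseCoeff {ω₂ lam β γ : ℝ} (hω : 0 < ω₂) (hl : 0 < lam)
    (hβ : 0 < β) (hγ : 0 < γ) (N : ℕ) {T : ℝ} (hT : 0 < T) :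
    ∃ D : ℝ, (pinnedChain ω₂ lam β γ).toSiteChain.IsResponseCoeff N T D := by
  classical
  -- uniqueness of weak steady states of the pinned chain (in tree)
  have hU : ∀ (M : ℕ) (T_L T_R : ℝ), 0 < T_L → 0 < T_R →
      ∀ μ ν : Measure (PhaseSpace M), (pinnedChain ω₂ lam β γ).IsSteadyState M T_L T_R μ →
        (pinnedChain ω₂ lam β γ).IsSteadyState M T_L T_R ν → μ = ν :=
    Summit.AtomisticToContinuum.FouriersLaw.Theses.MatthiessenLadder.NessUnique_holds
      ω₂ lam β γ hω hl hβ hγ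
  -- the canonical steady-state family at every size (choice over the in-tree existence theorem)
  let μ₀ : (M : ℕ) → ℝ → ℝ → Measure (PhaseSpace M) := fun M T_L T_R =>
    if h : 0 < T_L ∧ 0 < T_R then
      Classical.choose (pinnedChain_exists_isSteadyState hω hl hβ hγ M h.1 h.2) else 0
  have hμ₀ : ∀ (M : ℕ) (T_L T_R : ℝ), 0 < T_L → 0 < T_R →
      (pinnedChain ω₂ lam β γ).IsSteadyState M T_L T_R (μ₀ M T_L T_R) := by
    intro M T_L T_R h1 h2
    have h12 : 0 < T_L ∧ 0 < T_R := ⟨h1, h2⟩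
    simp only [μ₀, dif_pos h12]
    exact Classical.choose_spec (pinnedChain_exists_isSteadyState hω hl hβ hγ M h1 h2)
  obtain ⟨D, hD⟩ :=
    Summit.AtomisticToContinuum.FouriersLaw.Theorems.FourierGreenKubo.finiteResponse_of_unique
      ω₂ lam β γ hω hl hβ hγ hU μ₀ hμ₀ T hT N
  exact ⟨D, (isResponseCoeff_toSiteChain_iff _ N T D).2
    ⟨μ₀ N, fun T_L T_R h1 h2 => hμ₀ N T_L T_R h1 h2, hD⟩⟩

/-! ### The three clauses on all proper prefixes `k < N`, from the stubs -/

/-- **Existence on the proper prefixes** (PROVED from the stubs): `k = 0` is the Gaussian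
`harmonicNESS` (in tree); `0 < k < N` is `cellChain_exists_fellerSemigroup` + `prefixCesaroEnergyBound_of_stubs`
(`prefixSemigroupEnergyBound_of_stubs`) fed into the LANDED `stub_steadyStateOfSemigroupBound`
(Krylov–Bogoliubov + Dynkin, p146884). -/
theorem prefixExistence_of_stubs :
    ∀ ω₂ lam β γ : ℝ, 0 < ω₂ → 0 < lam → 0 < β → 0 < γ → ∀ k N : ℕ, k < N →
      ∀ T_L T_R : ℝ, 0 < T_L → 0 < T_R →
        ∃ μ : Measure (PhaseSpace N),
          (cellChain ω₂ lam β γ (fun i => decide (i < k))).IsSteadyState N T_L T_R μ := by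
  intro ω₂ lam β γ hω hl hβ hγ k N hkN T_L T_R hL hR
  rcases Nat.eq_zero_or_pos k with rfl | hk
  · rw [isSteadyState_prefix_zero]
    exact ⟨_, isSteadyState_harmonicNESS hω hγ N hL hR⟩
  · exact Summit.AtomisticToContinuum.FouriersLaw.Theorems.PrefixSteadyStates.LineRegistered.stub_steadyStateOfSemigroupBound
      ω₂ lam β γ hω hl.le hβ.le (fun i => decide (i < k)) N T_L T_R
      (prefixSemigroupEnergyBound_of_stubs ω₂ lam β γ hω hl hβ hγ k N hk hkN T_L T_R hL hR)

/-- **Uniqueness on the proper prefixes** (PROVED from the stubs): `k = 0` is the LANDED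
`stub_harmonicNessUnique` transported along `cellChain_const_false`; `0 < k < N` is
`prefixUniquenessPos_of_stubs` (U-a + U-b + U-c). -/
theorem prefixUniqueness_of_stubs :
    ∀ ω₂ lam β γ : ℝ, 0 < ω₂ → 0 < lam → 0 < β → 0 < γ → ∀ k N : ℕ, k < N →
      ∀ T_L T_R : ℝ, 0 < T_L → 0 < T_R →
        ∀ μ ν : Measure (PhaseSpace N),
          (cellChain ω₂ lam β γ (fun i => decide (i < k))).IsSteadyState N T_L T_R μ →
          (cellChain ω₂ lam β γ (fun i => decide (i < k))).IsSteadyState N T_L T_R ν → μ = ν := by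
  intro ω₂ lam β γ hω hl hβ hγ k N hkN T_L T_R hL hR μ ν hμ hν
  rcases Nat.eq_zero_or_pos k with rfl | hk
  · rw [isSteadyState_prefix_zero] at hμ hν
    exact Summit.AtomisticToContinuum.FouriersLaw.Theorems.PrefixSteadyStates.LineRegistered.stub_harmonicNessUnique
      ω₂ γ hω hγ N T_L T_R hL hR μ ν hμ hν
  · exact prefixUniquenessPos_of_stubs ω₂ lam β γ hω hl hβ hγ k N hk hkN T_L T_R hL hR μ ν hμ hν

/-- **Response on the proper prefixes** (PROVED from the stubs): `k = 0` is the LANDED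
`stub_prefixResponseZero` (no uniqueness needed); `0 < k < N` is `prefixResponseOfUniquePos_of_stubs`
(R-hard + R-soft) under existence + uniqueness at size `N`. -/
theorem prefixResponse_of_stubs :
    ∀ ω₂ lam β γ : ℝ, 0 < ω₂ → 0 < lam → 0 < β → 0 < γ → ∀ k N : ℕ, k < N →
      (∀ T_L T_R : ℝ, 0 < T_L → 0 < T_R →
        ∃ μ : Measure (PhaseSpace N),
          (cellChain ω₂ lam β γ (fun i => decide (i < k))).IsSteadyState N T_L T_R μ ∧
          ∀ ν : Measure (PhaseSpace N),
            (cellChain ω₂ lam β γ (fun i => decide (i < k))).IsSteadyState N T_L T_R ν → ν = μ) →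
      ∀ T : ℝ, 0 < T →
        ∃ D : ℝ, (cellChain ω₂ lam β γ (fun i => decide (i < k))).IsResponseCoeff N T D := by
  intro ω₂ lam β γ hω hl hβ hγ k N hkN hEU T hT
  rcases Nat.eq_zero_or_pos k with rfl | hk
  · exact Summit.AtomisticToContinuum.FouriersLaw.Theorems.PrefixSteadyStates.LineRegistered.stub_prefixResponseZero
      ω₂ lam β γ hω hγ N T hT
  · exact prefixResponseOfUniquePos_of_stubs ω₂ lam β γ hω hl hβ hγ k N hk hkN hEU T hT

/-! ### The composition: stubs ⟹ the crux, by name -/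

/-- **The composition (PROVED, no `sorry` outside the stubs, axioms `propext`, `Classical.choice`,
`Quot.sound`).** Proper prefixes `k < N`: existence and uniqueness (`prefixExistence_of_stubs`,
`prefixUniqueness_of_stubs`) give clause (1), which is exactly the hypothesis under which
`prefixResponse_of_stubs` gives the response coefficient. Saturated rungs `N ≤ k`: the rung is the
pinned chain at size `N`, and all three clauses are in-tree theorems
(`pinnedChain_exists_isSteadyState`, `NessUnique_holds`, `finiteResponse_of_unique` via
`pinnedChain_exists_isResponseCoeff`). -/
theorem prefixSteadyStates_of_clauses
    (hE : ∀ ω₂ lam β γ : ℝ, 0 < ω₂ → 0 < lam → 0 < β → 0 < γ → ∀ k N : ℕ, k < N →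
      ∀ T_L T_R : ℝ, 0 < T_L → 0 < T_R →
        ∃ μ : Measure (PhaseSpace N),
          (cellChain ω₂ lam β γ (fun i => decide (i < k))).IsSteadyState N T_L T_R μ)
    (hU : ∀ ω₂ lam β γ : ℝ, 0 < ω₂ → 0 < lam → 0 < β → 0 < γ → ∀ k N : ℕ, k < N →
      ∀ T_L T_R : ℝ, 0 < T_L → 0 < T_R →
        ∀ μ ν : Measure (PhaseSpace N),
          (cellChain ω₂ lam β γ (fun i => decide (i < k))).IsSteadyState N T_L T_R μ →
          (cellChain ω₂ lam β γ (fun i => decide (i < k))).IsSteadyState N T_L T_R ν → μ = ν)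
    (hR : ∀ ω₂ lam β γ : ℝ, 0 < ω₂ → 0 < lam → 0 < β → 0 < γ → ∀ k N : ℕ, k < N →
      (∀ T_L T_R : ℝ, 0 < T_L → 0 < T_R →
        ∃ μ : Measure (PhaseSpace N),
          (cellChain ω₂ lam β γ (fun i => decide (i < k))).IsSteadyState N T_L T_R μ ∧
          ∀ ν : Measure (PhaseSpace N),
            (cellChain ω₂ lam β γ (fun i => decide (i < k))).IsSteadyState N T_L T_R ν → ν = μ) →
      ∀ T : ℝ, 0 < T →
        ∃ D : ℝ, (cellChain ω₂ lam β γ (fun i => decide (i < k))).IsResponseCoeff N T D) :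
    PrefixSteadyStates := by
  intro ω₂ lam β γ hω hl hβ hγ k
  -- clause (1): existence and uniqueness of the weak steady state at every size
  have hEU : ∀ (N : ℕ) (T_L T_R : ℝ), 0 < T_L → 0 < T_R →
      ∃ μ : Measure (PhaseSpace N),
        (cellChain ω₂ lam β γ (fun i => decide (i < k))).IsSteadyState N T_L T_R μ ∧
        ∀ ν : Measure (PhaseSpace N),
          (cellChain ω₂ lam β γ (fun i => decide (i < k))).IsSteadyState N T_L T_R ν → ν = μ := by
    intro N T_L T_R hL hR'
    rcases lt_or_ge k N with hkN | hNk
    · -- proper prefix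
      obtain ⟨μ, hμ⟩ := hE ω₂ lam β γ hω hl hβ hγ k N hkN T_L T_R hL hR'
      exact ⟨μ, hμ, fun ν hν => hU ω₂ lam β γ hω hl hβ hγ k N hkN T_L T_R hL hR' ν μ hν hμ⟩
    · -- saturated rung: the pinned chain (in tree)
      rw [isSteadyState_prefix_of_le ω₂ lam β γ hNk]
      obtain ⟨μ, hμ⟩ := pinnedChain_exists_isSteadyState hω hl hβ hγ N hL hR'
      exact ⟨μ, hμ, fun ν hν =>
        Summit.AtomisticToContinuum.FouriersLaw.Theses.MatthiessenLadder.NessUnique_holds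
          ω₂ lam β γ hω hl hβ hγ N T_L T_R hL hR' ν μ hν hμ⟩
  refine ⟨hEU, fun N T hT => ?_⟩
  -- clause (2): the response coefficient at every size and temperature
  rcases lt_or_ge k N with hkN | hNk
  · exact hR ω₂ lam β γ hω hl hβ hγ k N hkN (hEU N) T hT
  · rw [isResponseCoeff_prefix_of_le ω₂ lam β γ hNk]
    exact pinnedChain_exists_isResponseCoeff hω hl hβ hγ N hT

/-- **`PrefixSteadyStates_of` — the line concludes the crux BY NAME** (the route decl
`Summit.AtomisticToContinuum.FouriersLaw.Theses.MatthiessenLadder.PrefixSteadyStates`) from the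
registered stubs `stub_prefixUniformDecay` (the ONE new-math estimate, CEHR Thm 5.1 for the mixed rung),
`stub_prefixExpBound`, `stub_prefixMixingOfDecay` (ports), and the LANDED stubs `stub_cellChainSmoothDensity` (p149198),
`stub_cellChainInvariantOfSteadyState` (p151514), `stub_cellChainInvariantUnique` (p149382),
`stub_prefixResponseOfUniformMixing` (p152137), the LANDED Literature construction `cellChain_exists_fellerSemigroup`
and the LANDED stubs `stub_steadyStateOfSemigroupBound` (p146884),
`stub_harmonicNessUnique` (p147364), `stub_prefixResponseZero` (p147366) through the sorry-free clauses
and composition above. -/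
theorem PrefixSteadyStates_of : PrefixSteadyStates :=
  prefixSteadyStates_of_clauses prefixExistence_of_stubs prefixUniqueness_of_stubs
    prefixResponse_of_stubs

end Summit.AtomisticToContinuum.FouriersLaw.Cruxes.PrefixSteadyStates.Birth

end
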